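import Literature.AnabelianGeometry.EtaleTheta.Discharge.Sec2Cor216OfModel

/-!
# [EtTh] Prop 2.14 (iii), bi-theta case, at the §1 MODEL: the `N·(l·ℤ)`-translations are
# automorphisms of the model bi-theta environment (modulo Prop 1.5 (ii), (iii) only)

Mochizuki, *The Étale Theta Function and its Frobenioid-theoretic Manifestations* [EtTh],
Publ. RIMS 45 (2009), §2, Prop 2.14 (iii) p.50 (locator `p.N` = PDF page of the PRIMS text; bib key
`MochizukiEtTh2009`). PROOF-ONLY companion (no `def`; seat abc-iut-L2-t2, §2 owner) of
`Discharge/Sec2Cor216OfModel.lean` (this seat) and `Discharge/Sec2NondiscretenessProofs.lean`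
(`ThetaEnvTower.exists_biIso_conjX`).

PRINT (Prop 2.14 (iii), p.50): "the resulting homomorphism `Aut(B) → (l·ℤ) ⋊ {±1}` has image
containing `(N·l·ℤ) ⋊ {±1}`": the `N·(l·ℤ)`-conjugates of the theta section differ from it by a
coboundary, so conjugation by them is an automorphism of the model bi-theta environment. Here, for the
§1 MODEL tower of `X̲̲` (abc-iut-L2-t8's `DoubleUnderline.thetaEnvTower`): for a GEOMETRIC `x ∈ Π^tp_X̲̲`
(`aug x = 1`) and `a ∈ ℤ` with `M ∣ a`, conjugation by `x^a` IS an automorphism of the mod-`M` model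
bi-theta environment `B_M(η)` of every theta cocycle `η` — from the bi-theta shift clause
`conjCocycle_zpow_modN_eq_mul_coboundary` (Prop 1.5 (ii), (iii) only). The `{±1}`-part (inversion
automorphisms) and the action on cusp LABELS (`RigidData.ActsOnCuspsBy`) are NOT addressed: the §1
interface types no inversion automorphism (Prop 1.5 (iii), last clause, untyped) and the model's
`CuspLabels` carry no equivariance axiom. HONEST FRAMING: no side is taken on [IUTchIII] Cor 3.12;
typed ≠ discharged elsewhere.
-/

noncomputable section

namespace Literature.AnabelianGeometry.EtaleTheta

open Literature.AnabelianGeometry.SemiGraphs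

namespace ThetaSetting.EtaleThetaData.DoubleUnderline

variable {p : ℕ} [Fact p.Prime] {D : ThetaSetting p} {E : D.EtaleThetaData} {l : ℕ}
  (C : E.DoubleUnderline l) {Es : Set ℕ+} (τ : D.CyclotomeTower l Es)

/-- **Prop 2.14 (iii) (bi-theta case), translation part, at the §1 model**: for a geometric
`x ∈ Π^tp_X̲̲` and `M ∣ a`, conjugation by `x^a` is an automorphism of the mod-`M` model bi-theta
environment `B_M(η)` attached to (the reduction of) any root cocycle — it normalises `D_Y`, carries
`[Im s^Θ_η]` to itself (by the coboundary of the shift clause) and `[Im s^alg]` to itself.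
Conditional only on Prop 1.5 (ii), (iii). [cite: MochizukiEtTh2009, Prop 2.14(iii) p.50] -/
theorem exists_biIso_conjX_zpow_of_model (hC : D.Compat) (hS : D.Sec2Hyps) (h15 : Prop15iii E hC)
    (h15ii : Prop15ii E.toKummerData hC) (M : Es)
    {f : contCocycles D.toTheta D.DeltaTheta C.GtpYdduu} (hf : f ∈ C.rootCocycles hC)
    (x : C.Huu) (hx : D.aug.toMonoidHom (x : D.PiTemp) = 1) (a : ℤ) (ha : (((M : ℕ+) : ℕ) : ℤ) ∣ a) :
    ∃ α : (((C.thetaEnvTower τ hC hS).level M).modelBi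
        (show C.modN (τ.mod M) f hf.1 ∈ (C.thetaEnvTower τ hC hS).thetaCocycles M from ⟨f, hf, rfl⟩)).Iso
      (((C.thetaEnvTower τ hC hS).level M).modelBi
        (show C.modN (τ.mod M) f hf.1 ∈ (C.thetaEnvTower τ hC hS).thetaCocycles M from ⟨f, hf, rfl⟩)),
      ∀ y, α.e y = ((C.thetaEnvTower τ hC hS).level M).conjX (x ^ a) y := by
  obtain ⟨c, hc⟩ := C.conjCocycle_zpow_modN_eq_mul_coboundary τ hC hS h15 h15ii M hf x hx a ha
  exact (C.thetaEnvTower τ hC hS).exists_biIso_conjX M ⟨f, hf, rfl⟩ (x ^ a) c hc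

/-- The same for EVERY theta cocycle of the model tower (each is the reduction of a root cocycle) and
the powers `x₁^a`, `M ∣ a`, of a geometric GENERATOR `x₁` of `Gal(Y̲̲/X̲̲)` — i.e. for the
`M·(l·ℤ)`-conjugates of print. [cite: MochizukiEtTh2009, Prop 2.14(iii) p.50] -/
theorem exists_generator_biIso_conjX_zpow_of_model (hC : D.Compat) (hS : D.Sec2Hyps)
    (h15 : Prop15iii E hC) (h15ii : Prop15ii E.toKummerData hC) :
    ∃ x₁ : C.Huu, (C.thetaEnvTower τ hC hS).galYX (QuotientGroup.mk x₁) = Multiplicative.ofAdd (1 : ℤ) ∧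
      D.aug.toMonoidHom (x₁ : D.PiTemp) = 1 ∧
      ∀ (M : Es) (η : (C.thetaEnvTower τ hC hS).PiYdd → (C.thetaEnvTower τ hC hS).mu M)
        (hη : η ∈ (C.thetaEnvTower τ hC hS).thetaCocycles M) (a : ℤ), (((M : ℕ+) : ℕ) : ℤ) ∣ a →
        ∃ α : (((C.thetaEnvTower τ hC hS).level M).modelBi hη).Iso
            (((C.thetaEnvTower τ hC hS).level M).modelBi hη),
          ∀ y, α.e y = ((C.thetaEnvTower τ hC hS).level M).conjX (x₁ ^ a) y := by
  obtain ⟨x₁, hx1, -, hx⟩ := C.exists_geometric_generator τ hC hS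
  refine ⟨x₁, hx1, hx, fun M η hη a ha => ?_⟩
  obtain ⟨f, hf, rfl⟩ := hη
  obtain ⟨c, hc⟩ := C.conjCocycle_zpow_modN_eq_mul_coboundary τ hC hS h15 h15ii M hf x₁ hx a ha
  exact (C.thetaEnvTower τ hC hS).exists_biIso_conjX M ⟨f, hf, rfl⟩ (x₁ ^ a) c hc

end ThetaSetting.EtaleThetaData.DoubleUnderline

end Literature.AnabelianGeometry.EtaleTheta

end
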